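import Literature.AnabelianGeometry.SemiGraphs.PSCSmoothCurveGenuineRestrict
import Literature.AnabelianGeometry.SemiGraphs.PSCSmoothCurveShapeRepresentatives
import Literature.AnabelianGeometry.SemiGraphs.PSCSeparatingCoveringsSmoothCurveRepresentatives
import HarnessLib

/-!
# A covering-closed GENUINE origin of smooth curves for the [CombGC] §1 schemata

Mochizuki, *A combinatorial version of the Grothendieck conjecture* [CombGC], Tohoku Math. J. **59**
(2007), §1 pp. 6–14: Def. 1.1 (i) "of pro-Σ PSC-type", (ii) "a finite étale covering of `G` that arises
from an open subgroup of `Π_G`" is again of PSC-type; Prop. 1.2 (i)(ii) p. 8 and its proof p. 9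
(separating coverings); Prop. 1.5 (i)(ii) p. 12; Thm. 1.6 (iii) p. 13.
[cite: MochizukiCombGC2007, Def 1.1(ii) p.6] [cite: MochizukiCombGC2007, §1 pp.8-13]

PROOF-ONLY file (abc-iut cell, layer L3, [CombGC] non-vacuity programme; seat abc-iut-w5-d195 gen 7,
support brick «SC-GENUINE-COVERING-CLOSED», part C = assembly).  The printed statements of [CombGC] §1
are typed (abc-iut-L3-t4, -w4-d081, -f-165/166) as schemata `…Holds Ω` over an origin parameter
`Ω : PSCOrigin`, among them the REPAIRED Def. 1.1 (ii) `RestrictBDOfPSCTypeHolds Ω` ("finite étale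
coverings of `Ω`-data are `Ω`-data"), an origin-level INPUT of the tree's derivations of Prop. 1.2 /
Thm. 1.6.  The genuine smooth-PROPER origin (`PSCSmoothProperGenuineOrigin.lean`) witnesses this input
jointly with the §1 schemata at data WITHOUT cusps; the smooth-curve origin `Ω_sc` of
`PSCSmoothCurveShape.lean` (cusp groups EXACTLY the closed cusp inertia groups) has cusps but is not
covering-closed.  Here the GENUINE smooth-CURVE origin `Ω_scg`:

  data over a PROFINITE group with one vertex `Π_v = Π`, no nodes, a pro-`Σ` completion
  `ι : Γ_{g,r} → Π` of a hyperbolic punctured surface group (`Σ = G.Sigma`), `genus(v) = g`, a bijection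
  `e : cusps ≃ Fin r`, and cusp groups ANY representatives `δ_c · closure ι⟨c_{e c}⟩ · δ_c⁻¹` of the
  cuspidal conjugacy classes (Def. 1.1 (ii): "determines, up to conjugation, a closed subgroup"),

is shown (`exists_smoothCurveGenuineOrigin_holds`) to be

* INHABITED by the datum of every smooth hyperbolic curve of type `(g, r)` in characteristic `0`
  (`Π = Γ̂_{g,r}`, Mathlib's profinite completion, `Σ` = all primes) — in particular by the tripod
  `P¹ ∖ {0,1,∞}` (`Π = F̂₂`, three cusps), so every cusp quantifier below is NON-vacuous;
* COVERING-CLOSED: **`RestrictBDOfPSCTypeHolds Ω_scg`** (by `restrict_smoothCurveGenuine` of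
  `PSCSmoothCurveGenuineRestrict.lean`: the level is `Γ_{g',r'}` with its peripheral structure,
  Riemann–Hurwitz genus, `U`-conjugate cusp groups — whence the relaxed cusp clause);
* a joint witness of F-2830 (`SeparatingCoveringsHolds`, abc-iut-f-166's relaxed-clause instance
  `separatingCoverings_of_smoothCurve'`), F-0438 (Prop. 1.2 (ii)), F-0459 (Prop. 1.2 (i)), F-0443
  (Prop. 1.5 (ii)) (`PSCSmoothCurveShapeRepresentatives.lean`), F-0440 (Prop. 1.5 (i)) and F-0461
  (Thm. 1.6 (iii)) (abc-iut-L3-t4, clause-free), with every `Ω_scg`-datum profinite.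

Consistency / non-vacuity evidence for the typed family at GENUINE one-component data with cusps and ALL
their finite étale coverings; not the printed theorems for all pointed stable curves; 0 definitions;
nothing here takes a side on [IUTchIII] Cor. 3.12.
-/

noncomputable section

namespace Literature.AnabelianGeometry.SemiGraphs

namespace PSCDatum

open scoped Pointwise
open Literature.GroupTheory.CombinatorialGroupTheory
open Literature.GroupTheory.CombinatorialGroupTheory.PuncturedSurfaceGroup (cuspInertia IsHyperbolicType)
open SemiGraphOfAnabelioids (IsProSigmaCompletion)
open Literature.IUT.HodgeTheaters (profiniteCompletion toCompletion)

/-- **The GENUINE smooth-curve origin is inhabited (by every hyperbolic type `(g,r)`), covering-closed,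
and the [CombGC] §1 schemata F-2830 ∧ F-0438 ∧ F-0459 ∧ F-0440 ∧ F-0461 ∧ F-0443 hold at it.**  Let
`Ω_scg` declare "of PSC-type" exactly the data over a PROFINITE group with no nodes, one vertex with
`Π_v = Π`, a pro-`Σ` completion `ι : Γ_{g,r} → Π` (`Σ = G.Sigma`) of a hyperbolic punctured surface group
with `genus(v) = g`, a bijection `e : cusps ≃ Fin r`, and cusp groups conjugates
`δ_c · closure ι⟨c_{e c}⟩ · δ_c⁻¹` of the closed cusp inertia groups.  Then: for every hyperbolic `(g, r)`
the datum of a smooth curve of type `(g, r)` in characteristic `0` (`Π = Γ̂_{g,r}` the profinite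
completion, `Σ` = all primes, one vertex of genus `g`, `r` cusps `closure η⟨c_i⟩`) lies in `Ω_scg`;
**`RestrictBDOfPSCTypeHolds Ω_scg`** (Def. 1.1 (ii): every finite étale covering `G_U` of an
`Ω_scg`-datum is an `Ω_scg`-datum — `restrict_smoothCurveGenuine`); every `Ω_scg`-datum is profinite,
node-free, one-vertex with `Π_v = Π`; and `SeparatingCoveringsHolds Ω_scg` (F-2830, Prop. 1.2 proof
p. 9), `CommensurableTerminalityHolds Ω_scg` (F-0438, Prop. 1.2 (ii)), `OpenInterDeterminesComponentHolds
Ω_scg` (F-0459, Prop. 1.2 (i)), `EdgeLikeIncidenceHolds Ω_scg` (F-0440, Prop. 1.5 (i)),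
`UnrVerticialIffHolds Ω_scg` (F-0461, Thm. 1.6 (iii)), `GraphicIffEdgeLikeVerticialHolds Ω_scg` (F-0443,
Prop. 1.5 (ii)).  Genuine anabelian content: the tree's theorems on finite-index subgroups of punctured
surface groups (F-3146), malnormality of pro-`Σ` cusp inertia ([SemiAnbd] Ex. 2.10), mixed cusp
quotients.  Non-vacuity evidence at genuine data, not the printed theorems for all pointed stable curves.
[cite: MochizukiCombGC2007, Def 1.1(ii) p.6] -/
theorem exists_smoothCurveGenuineOrigin_holds :
    ∃ Ω : PSCOrigin.{0},
      (∀ g r : ℕ, IsHyperbolicType g r →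
        ∃ G : PSCDatum (profiniteCompletion (PuncturedSurfaceGroup g r)),
          Ω.IsOfPSCType G ∧ G.Sigma = {p : ℕ | p.Prime} ∧ G.graph.i = 1 ∧ G.graph.n = 0 ∧ G.graph.r = r ∧
            (∀ v, G.vertGp v = ⊤ ∧ G.genus v = g) ∧
            IsProSigmaCompletion G.Sigma (toCompletion (PuncturedSurfaceGroup g r)) ∧
            ∃ e : G.graph.C ≃ Fin r, ∀ c, G.cuspGp c =
              ((cuspInertia (g := g) (e c)).map (toCompletion (PuncturedSurfaceGroup g r))).topologicalClosure) ∧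
      RestrictBDOfPSCTypeHolds Ω ∧
      (∀ ⦃Q : Type⦄ [Group Q] [TopologicalSpace Q] [IsTopologicalGroup Q] (G : PSCDatum Q),
        Ω.IsOfPSCType G → CompactSpace Q ∧ T2Space Q ∧ TotallyDisconnectedSpace Q ∧ IsEmpty G.graph.N ∧
          (∀ v, G.vertGp v = ⊤) ∧ ∃ v₀ : G.graph.V, ∀ w, w = v₀) ∧
      SeparatingCoveringsHolds Ω ∧ CommensurableTerminalityHolds Ω ∧ OpenInterDeterminesComponentHolds Ω ∧
      EdgeLikeIncidenceHolds Ω ∧ UnrVerticialIffHolds Ω ∧ GraphicIffEdgeLikeVerticialHolds Ω := by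
  let Ω : PSCOrigin.{0} :=
    ⟨fun {Q} _ _ G => ∃ (_ : IsTopologicalGroup Q), CompactSpace Q ∧ T2Space Q ∧
      TotallyDisconnectedSpace Q ∧ IsEmpty G.graph.N ∧ (∀ v, G.vertGp v = ⊤) ∧
      (∃ v₀ : G.graph.V, ∀ w, w = v₀) ∧
      ∃ (g r : ℕ) (ι : PuncturedSurfaceGroup g r →* Q) (e : G.graph.C ≃ Fin r),
        IsHyperbolicType g r ∧ IsProSigmaCompletion G.Sigma ι ∧ (∀ v, G.genus v = g) ∧
        ∀ c, ∃ δ : ConjAct Q, G.cuspGp c = δ • ((cuspInertia (g := g) (e c)).map ι).topologicalClosure⟩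
  -- the shape hypotheses of the instance forms, read off `Ω`
  have hΩ₁ : ∀ ⦃Q : Type⦄ [Group Q] [TopologicalSpace Q] [IsTopologicalGroup Q] (G : PSCDatum Q),
      Ω.IsOfPSCType G → CompactSpace Q ∧ T2Space Q ∧ TotallyDisconnectedSpace Q ∧ IsEmpty G.graph.N ∧
        (∀ v, G.vertGp v = ⊤) ∧ (∃ v₀ : G.graph.V, ∀ w, w = v₀) ∧
        ∃ (S : Set ℕ) (g r : ℕ) (ι : PuncturedSurfaceGroup g r →* Q) (e : G.graph.C ≃ Fin r),
          S.Nonempty ∧ (∀ p ∈ S, p.Prime) ∧ IsHyperbolicType g r ∧ IsProSigmaCompletion S ι ∧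
          ∀ c, ∃ δ : ConjAct Q, G.cuspGp c =
            δ • ((cuspInertia (g := g) (e c)).map ι).topologicalClosure := by
    intro Q _ _ _ G hG
    obtain ⟨_, hc, ht, hd, hN, hV, hv, g, r, ι, e, hgr, hι, -, hC⟩ := hG
    exact ⟨hc, ht, hd, hN, hV, hv, G.Sigma, g, r, ι, e, G.sigma_nonempty, G.sigma_prime, hgr, hι, hC⟩
  have hΩ₂ : ∀ ⦃Q : Type⦄ [Group Q] [TopologicalSpace Q] (G : PSCDatum Q), Ω.IsOfPSCType G →
      IsEmpty G.graph.N ∧ (∀ v, G.vertGp v = ⊤) ∧ Nonempty G.graph.V := by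
    intro Q _ _ G hG
    obtain ⟨_, -, -, -, hN, hV, ⟨v₀, -⟩, -⟩ := hG
    exact ⟨hN, hV, ⟨v₀⟩⟩
  refine ⟨Ω, fun g r hgr => ?_, ?_, ?_, ?_, commensurableTerminalityHolds_of_smoothCurve' Ω hΩ₁,
    openInterDeterminesComponentHolds_of_smoothCurve' Ω (fun Q _ _ _ G hG => ?_),
    edgeLikeIncidenceHolds_of_vertGp_eq_top Ω hΩ₂,
    unrVerticialIffHolds_of_vertGp_eq_top Ω (fun Q _ _ G hG => ⟨(hΩ₂ G hG).2.1, (hΩ₂ G hG).2.2⟩),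
    graphicIffEdgeLikeVerticialHolds_of_smoothCurve' Ω hΩ₁ hΩ₂⟩
  · -- inhabitation: the smooth curve of type `(g, r)` in characteristic `0`
    let Γ := PuncturedSurfaceGroup g r
    let η := toCompletion Γ
    have hη : IsProSigmaCompletion {p : ℕ | p.Prime} η :=
      SemiGraphOfAnabelioids.IsProSigmaCompletion.isProSigmaCompletion_toCompletion Γ
    let T : PSCDatum (profiniteCompletion Γ) :=
      { Sigma := {p | p.Prime}
        sigma_prime := fun _ hp => hp
        sigma_nonempty := ⟨2, Nat.prime_two⟩
        graph := { V := Unit, N := Empty, C := Fin r, nodeEnds := Empty.elim, cuspEnd := fun _ => () }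
        vertGp := fun _ => ⊤
        nodeGp := Empty.elim
        cuspGp := fun i => ((cuspInertia (g := g) i).map η).topologicalClosure
        genus := fun _ => g
        isClosed_vertGp := fun _ => by rw [Subgroup.coe_top]; exact isClosed_univ
        isClosed_nodeGp := fun e => e.elim
        isClosed_cuspGp := fun _ => Subgroup.isClosed_topologicalClosure _
        nodeGp_le := fun e => e.elim
        cuspGp_le := fun _ => ⟨1, le_top⟩
        proSigma := ⟨fun _ _ _ hp _ => hp⟩ }
    have hT : Ω.IsOfPSCType T :=
      ⟨inferInstance, inferInstance, inferInstance, inferInstance, inferInstanceAs (IsEmpty Empty),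
        fun _ => rfl, ⟨(), fun _ => rfl⟩, g, r, η, Equiv.refl _, hgr, hη, fun _ => rfl,
        fun c => ⟨1, by rw [one_smul]; rfl⟩⟩
    exact ⟨T, hT, rfl, rfl, rfl, Fintype.card_fin r, fun _ => ⟨rfl, rfl⟩, hη, Equiv.refl _, fun _ => rfl⟩
  · -- RestrictBDOfPSCTypeHolds: `restrict_smoothCurveGenuine`
    intro Q _ _ _ H hH
    obtain ⟨_, hc, ht, hd, hN, hV, ⟨v₀, hv⟩, g, r, ι, e, hgr, hι, hgen, hC⟩ := hH
    refine ⟨H.chosenBranchData, fun U _ hU => ?_⟩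
    rw [restrictBD_chosen]
    haveI : CompactSpace U := isCompact_iff_compactSpace.mp (U.isClosed_of_isOpen hU).isCompact
    obtain ⟨hN', hV', hv', g', r', ι', e', h', hι', -, hgen', hC'⟩ :=
      H.restrict_smoothCurveGenuine U hU hV v₀ hv hgr ι hι e hC hgen
    exact ⟨inferInstance, inferInstance, inferInstance, inferInstance, hN', hV', hv', g', r', ι', e', h',
      hι', hgen', hC'⟩
  · -- profiniteness and shape of every `Ω`-datum
    intro Q _ _ _ H hH
    obtain ⟨_, hc, ht, hd, hN, hV, hv, -⟩ := hH
    exact ⟨hc, ht, hd, hN, hV, hv⟩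
  · -- F-2830: abc-iut-f-166's separating coverings under the relaxed cusp clause
    intro Q _ _ _ G hG
    obtain ⟨_, hc, ht, hd, hN, hV, ⟨v₀, hv⟩, g, r, ι, e, hgr, hι, -, hC⟩ := hG
    exact G.separatingCoverings_of_smoothCurve' G.sigma_nonempty G.sigma_prime hgr ι hι e
      (fun c => (hC c).elim fun δ h => ⟨ConjAct.ofConjAct δ, by rwa [ConjAct.toConjAct_ofConjAct]⟩)
      hV v₀ hv
  · obtain ⟨h1, h2, h3, h4, -, h6, h7⟩ := hΩ₁ G hG
    exact ⟨h1, h2, h3, h4, h6, h7⟩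

end PSCDatum

end Literature.AnabelianGeometry.SemiGraphs

end
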